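import Summits.BirchSwinnertonDyer.BirchSwinnertonDyer.Theses.TameQuarticManinParity
import Literature.NumberTheory.Automorphic.BCDTModularityModPProofs
import Literature.NumberTheory.EllipticCurves.HasseWeilGoodReductionProofs
import Literature.NumberTheory.GaloisRepresentations.ModNCyclotomicCharacter
import Literature.NumberTheory.GaloisRepresentations.ChebotarevOpenSubgroup
import Literature.NumberTheory.GaloisRepresentations.ArtinDirichletCoefficients
import Mathlib.LinearAlgebra.Matrix.Charpoly.Coeff
import Mathlib.LinearAlgebra.Matrix.GeneralLinearGroup.Card
import Mathlib.GroupTheory.PGroup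
import HarnessLib

/-!
# Route `TameQuarticManinParity`, helpers for stub B30 `IrrModThreeSplitTraceWitness` (stmt-BirchSwinnertonDyer-23598):
# Frobenius twins for `ρ̄_{W,3}` and `χ_M` (Chebotarev transport), and `2 × 2` unipotents / involutions over `𝔽₃`

Lead seat `cruxlead-stmt-BirchSwinnertonDyer-23367` g0, line `abelian-fixed-points` (= LINE 29/30 of the pen
bsd-idea-3 g9), registered stub `stub_traceWitness` of the crux MS (stmt-23367) — this file holds the HELPERS, the stub itself is
`TameQuarticManinParityIrrModThreeSplitTraceWitness`. THEOREMS ONLY: no definition, no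
named fact, no `sorry`. Inputs, all PROVED in the tree: the framed mod-`3` representation of `W`
(`exists_isTorsionGaloisRep`), its Frobenius characteristic polynomials `X² − a_p X + p`
(`IsTorsionGaloisRep.charpoly_eq_of_isArithFrobAt` with `trace_/det_galoisRepTate_frobenius_of_hasGoodReductionAt_holds`),
the mod-`N` cyclotomic character with its values at Frobenius and complex conjugation
(`ModNCyclotomicCharacter`), Chebotarev in the form `exists_isArithFrobAt_mul_inv_mem_not_mem`, and
`p`-group / Lagrange bookkeeping in `GL₂(𝔽₃)` (Mathlib).

## Proof (Serre 1972 §2 style; the pen's docstring of stmt-23598)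

Put `M = 3N_W`, `K = ker χ_M ⊴ Γ_ℚ` (so `Γ_ℚ/K` is abelian). By Chebotarev every `g ∈ Γ_ℚ` has a Frobenius
twin `φ` at a prime `p ∤ 3N_W` with `ρ̄(φ) = ρ̄(g)`, `χ_M(φ) = χ_M(g)`, and `charpoly ρ̄(g) = X² − ā_p X + p̄`,
`χ_M(g) = p̄`. If the conclusion failed, every `g ∈ K` would have `p ≡ 1 (mod 3N)` and `a_p ≡ 2`, i.e.
`charpoly ρ̄(g) = (X − 1)²`, so `U = ρ̄(K)` consists of unipotents: a `3`-subgroup of `GL₂(𝔽₃)` (order `48`), hence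
of order `≤ 3`, cyclic. If `U ≠ 1`, the fixed line of a generator is `Γ_ℚ`-stable (`K` is normal); if `U = 1`,
`ρ̄(Γ_ℚ)` is abelian and commutes with `ρ̄(c)`, `c` complex conjugation, an involution of determinant
`χ_3(c) = −1`, whose `+1`-eigenline is then `Γ_ℚ`-stable. Either way `E[3]` has a `Γ_ℚ`-stable subgroup of
order `3`, contradicting irreducibility.
-/

set_option autoImplicit false
-- D-0017: single-problem summit, so `Summit.BirchSwinnertonDyer.BirchSwinnertonDyer.…` repeats a namespace BY DESIGN.
set_option linter.dupNamespace false

noncomputable section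

open scoped NumberField Polynomial
open Polynomial IsDedekindDomain NumberField Field
open Literature.NumberTheory.GaloisRepresentations Rat.HeightOneSpectrum

namespace Summit.BirchSwinnertonDyer.BirchSwinnertonDyer.Theorems.TameQuarticManinParity

open Summit.BirchSwinnertonDyer.BirchSwinnertonDyer.Theses.TameQuarticManinParity

section Transport

variable (W : WeierstrassCurve ℚ) [W.IsElliptic] [NeZero (W.conductorNorm ℤ)]

/-- **Frobenius twins (Chebotarev transport).** For the framed mod-`3` representation `ρ̄` of `W`, a modulus `M`
and any `g ∈ Γ_ℚ` there is a prime `p ∤ 3·N_W·M` with `χ_M(g) = p (mod M)` and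
`charpoly ρ̄(g) = X² − a_p(W) X + p (mod 3)` (Chebotarev applied to the open normal subgroup
`ker ρ̄ ∩ ker χ_M`, then the Frobenius characteristic polynomial of `ρ̄_{W,3}` and `χ_M(Frob_p) = p`).
[cite: Serre1972, §2] -/
theorem exists_prime_frobTwin (M : ℕ) [NeZero M] {ρ : ModPGaloisRep ℚ (ZMod 3) 2}
    (hρ : W.IsTorsionGaloisRep 3 ρ) (g : absoluteGaloisGroup ℚ) :
    ∃ p : ℕ, p.Prime ∧ p ≠ 3 ∧ ¬ p ∣ W.conductorNorm ℤ ∧ ¬ p ∣ M ∧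
      ((modNCyclotomicCharacter ℚ M g : (ZMod M)ˣ) : ZMod M) = (p : ZMod M) ∧
      ((ρ g : GL (Fin 2) (ZMod 3)) : Matrix (Fin 2) (Fin 2) (ZMod 3)).charpoly =
        X ^ 2 - C ((W.LFunction p : ℤ) : ZMod 3) * X + C ((p : ℕ) : ZMod 3) := by
  classical
  haveI : Fact (Nat.Prime 3) := ⟨Nat.prime_three⟩
  set χ := modNCyclotomicCharacter ℚ M with hχdef
  -- the open normal subgroup `K₀ = ker ρ ∩ ker χ`
  set K₀ : Subgroup (absoluteGaloisGroup ℚ) := (MonoidHom.prod ρ.toMonoidHom χ).ker with hK₀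
  haveI : K₀.Normal := MonoidHom.normal_ker _
  have hρker : IsOpen ((ρ.toMonoidHom.ker : Subgroup (absoluteGaloisGroup ℚ)) :
      Set (absoluteGaloisGroup ℚ)) := by
    have e : ((ρ.toMonoidHom.ker : Subgroup (absoluteGaloisGroup ℚ)) : Set (absoluteGaloisGroup ℚ)) =
        ρ ⁻¹' {1} := by
      ext g'
      simp [MonoidHom.mem_ker]
    rw [e]
    exact (isOpen_discrete _).preimage (map_continuous ρ)
  have hχker : IsOpen ((χ.ker : Subgroup (absoluteGaloisGroup ℚ)) : Set (absoluteGaloisGroup ℚ)) := by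
    refine Subgroup.isOpen_of_mem_nhds _ (g := 1) ?_
    have h := modNCyclotomicCharacter_eventually_eq_one ℚ M
    rw [Filter.Eventually] at h
    exact Filter.mem_of_superset h fun σ hσ ↦ by simpa [MonoidHom.mem_ker, hχdef] using hσ
  have hK₀open : IsOpen (K₀ : Set (absoluteGaloisGroup ℚ)) := by
    have e : (K₀ : Set (absoluteGaloisGroup ℚ)) =
        ((ρ.toMonoidHom.ker : Subgroup (absoluteGaloisGroup ℚ)) : Set (absoluteGaloisGroup ℚ)) ∩
          ((χ.ker : Subgroup (absoluteGaloisGroup ℚ)) : Set (absoluteGaloisGroup ℚ)) := by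
      ext g'
      simp [hK₀, MonoidHom.mem_ker, Prod.ext_iff]
    rw [e]
    exact hρker.inter hχker
  -- the finite set of places over the primes dividing `3 · N_W · M`
  have hS : {v : HeightOneSpectrum (𝓞 ℚ) |
      ((primesEquiv v : Nat.Primes) : ℕ) ∣ 3 * W.conductorNorm ℤ * M}.Finite := by
    have hne : 3 * W.conductorNorm ℤ * M ≠ 0 :=
      mul_ne_zero (mul_ne_zero three_ne_zero (NeZero.ne _)) (NeZero.ne M)
    have hfin : {q : Nat.Primes | (q : ℕ) ∣ 3 * W.conductorNorm ℤ * M}.Finite := by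
      refine ((3 * W.conductorNorm ℤ * M).primeFactors.finite_toSet.preimage
        Nat.Primes.coe_nat_injective.injOn).subset ?_
      intro q hq
      simp only [Set.mem_preimage, Finset.mem_coe, Nat.mem_primeFactors]
      exact ⟨q.2, hq, hne⟩
    have e : {v : HeightOneSpectrum (𝓞 ℚ) | ((primesEquiv v : Nat.Primes) : ℕ) ∣ 3 * W.conductorNorm ℤ * M} =
        primesEquiv ⁻¹' {q : Nat.Primes | (q : ℕ) ∣ 3 * W.conductorNorm ℤ * M} := rfl
    rw [e]
    exact Set.Finite.preimage primesEquiv.injective.injOn hfin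
  -- Chebotarev
  obtain ⟨v, hvS, -, 𝔓, h𝔓, φ, hφ, hφg⟩ :=
    exists_isArithFrobAt_mul_inv_mem_not_mem ℚ K₀ hK₀open g _ hS
  set p : ℕ := ((primesEquiv v : Nat.Primes) : ℕ) with hpdef
  have hpp : p.Prime := (primesEquiv v).2
  have hpdvd : ¬ p ∣ 3 * W.conductorNorm ℤ * M := hvS
  have hp3 : p ≠ 3 := fun h ↦ hpdvd (by rw [h]; exact dvd_mul_of_dvd_left (dvd_mul_right 3 _) M)
  have hpN : ¬ p ∣ W.conductorNorm ℤ := fun h ↦ hpdvd (dvd_mul_of_dvd_left (dvd_mul_of_dvd_right h 3) M)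
  have hpM : ¬ p ∣ M := fun h ↦ hpdvd (dvd_mul_of_dvd_right h _)
  -- `ρ φ = ρ g`, `χ φ = χ g`
  have hmem : φ * g⁻¹ ∈ K₀ := hφg
  rw [hK₀, MonoidHom.mem_ker, MonoidHom.prod_apply, Prod.mk_eq_one, map_mul, map_mul, map_inv, map_inv,
    mul_inv_eq_one, mul_inv_eq_one] at hmem
  obtain ⟨hρφ, hχφ⟩ := hmem
  -- good reduction at `v`, `3 ∉ v`
  have hgood : W.HasGoodReductionAt v := by
    by_contra h
    exact hpN ((W.dvd_conductorNorm_iff v).mpr h)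
  have hℓv : ((3 : ℕ) : 𝓞 ℚ) ∉ v.asIdeal := by
    rw [Literature.NumberTheory.GaloisRepresentations.Rat.natCast_mem_asIdeal_iff]
    exact fun h ↦ hp3 ((Nat.prime_dvd_prime_iff_eq hpp Nat.prime_three).mp h)
  refine ⟨p, hpp, hp3, hpN, hpM, ?_, ?_⟩
  · -- `χ_M(g) = χ_M(φ) = N v = p`
    have hMP : (M : absIntegers (𝓞 ℚ) ℚ) ∉ 𝔓 := Rat.natCast_not_mem_of_mem_primesAbove_of_not_dvd h𝔓 hpM
    rw [← hχφ, hχdef, modNCyclotomicCharacter_eq_residueCard_of_isArithFrobAt h𝔓 hMP hφ,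
      Rat.residueCard_eq_natGenerator']
    have hgen := Rat.natGenerator_primesEquiv_symm (primesEquiv v)
    rw [Equiv.symm_apply_apply] at hgen
    rw [hgen]
  · -- the Frobenius characteristic polynomial
    have hch := hρ.charpoly_eq_of_isArithFrobAt
      (W.trace_galoisRepTate_frobenius_of_hasGoodReductionAt_holds 3)
      (W.det_galoisRepTate_frobenius_of_hasGoodReductionAt_holds 3) hℓv hgood h𝔓 hφ
    rw [WeierstrassCurve.natCard_residueField_adicCompletionIntegers,
      ← W.lFunction_primesEquiv_eq_frobeniusTraceAt hgood] at hch
    have hρφ' : (ρ φ : GL (Fin 2) (ZMod 3)) = ρ g := hρφ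
    rw [← hρφ', hch]

end Transport

/-! ### `2 × 2` matrices over `𝔽₃`: unipotents and involutions -/

section Matrices

/-- A `2 × 2` matrix over `𝔽₃` with characteristic polynomial `(X − 1)²` is unipotent: `(A − 1)² = 0`
(Cayley–Hamilton), hence `A³ = 1` in characteristic `3`. [folklore] -/
theorem sub_one_sq_eq_zero_of_charpoly {A : Matrix (Fin 2) (Fin 2) (ZMod 3)}
    (h : A.charpoly = X ^ 2 - C (2 : ZMod 3) * X + C (1 : ZMod 3)) :
    (A - 1) ^ 2 = 0 ∧ A ^ 3 = 1 := by
  have hCH := Matrix.aeval_self_charpoly A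
  rw [h] at hCH
  simp only [map_add, map_sub, map_mul, map_pow, Polynomial.aeval_X, map_ofNat, map_one] at hCH
  have h1 : (A - 1) ^ 2 = 0 := by
    rw [← hCH]
    noncomm_ring
  refine ⟨h1, ?_⟩
  have h3 : (3 : Matrix (Fin 2) (Fin 2) (ZMod 3)) = 0 := by
    have h := CharP.cast_eq_zero (Matrix (Fin 2) (Fin 2) (ZMod 3)) 3
    exact_mod_cast h
  have e : A ^ 3 = (A - 1) ^ 2 * (A - 1) + 3 * (A * (A - 1)) + 1 := by noncomm_ring
  rw [e, h1, h3, zero_mul, zero_mul, zero_add, zero_add]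

/-- The determinant is the constant coefficient of the characteristic polynomial (`2 × 2`). [folklore] -/
theorem det_eq_of_charpoly_eq {A : Matrix (Fin 2) (Fin 2) (ZMod 3)} {a b : ZMod 3}
    (h : A.charpoly = X ^ 2 - C a * X + C b) : A.det = b := by
  have h2 := Matrix.charpoly_fin_two A
  rw [h] at h2
  have hc := congrArg (fun q : (ZMod 3)[X] ↦ q.coeff 0) h2
  simp only [coeff_add, coeff_sub, coeff_C_mul, coeff_X_pow, coeff_X_zero, coeff_C_zero, mul_zero,
    sub_zero] at hc
  simpa using hc.symm

/-- For a unipotent `A ≠ 1` (`(A − 1)² = 0`) the fixed space `ker(A − 1)` is a proper non-zero subspace.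
[folklore] -/
theorem ker_sub_one_ne_of_unipotent {A : Matrix (Fin 2) (Fin 2) (ZMod 3)} (h : (A - 1) ^ 2 = 0) (hA : A ≠ 1) :
    LinearMap.ker (Matrix.toLin' (A - 1)) ≠ ⊥ ∧ LinearMap.ker (Matrix.toLin' (A - 1)) ≠ ⊤ := by
  constructor
  · intro hbot
    -- `(A − 1)` injective and `(A − 1)² = 0` force `Fin 2 → 𝔽₃` to be zero
    have hinj : ∀ x, Matrix.toLin' (A - 1) x = 0 → x = 0 := fun x hx ↦ by
      have : x ∈ LinearMap.ker (Matrix.toLin' (A - 1)) := hx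
      rwa [hbot, Submodule.mem_bot] at this
    have hx : (Pi.single 0 1 : Fin 2 → ZMod 3) = 0 := by
      refine hinj _ (hinj _ ?_)
      rw [← LinearMap.comp_apply, ← Matrix.toLin'_mul, ← sq, h, map_zero, LinearMap.zero_apply]
    have := congrFun hx 0
    simp at this
  · intro htop
    apply hA
    have h0 : Matrix.toLin' (A - 1) = 0 := LinearMap.ker_eq_top.mp htop
    rw [LinearEquiv.map_eq_zero_iff] at h0
    exact sub_eq_zero.mp h0

/-- For an involution `u` (`u² = 1`) of determinant `−1`, the `+1`-eigenspace `ker(u − 1)` is a proper non-zero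
subspace. [folklore] -/
theorem ker_sub_one_ne_of_involution {u : Matrix (Fin 2) (Fin 2) (ZMod 3)} (h : u * u = 1) (hdet : u.det = -1) :
    LinearMap.ker (Matrix.toLin' (u - 1)) ≠ ⊥ ∧ LinearMap.ker (Matrix.toLin' (u - 1)) ≠ ⊤ := by
  constructor
  · intro hbot
    -- `(u − 1)(u + 1) = 0` with `u − 1` injective gives `u = −1`, of determinant `1`
    have hinj : ∀ x, Matrix.toLin' (u - 1) x = 0 → x = 0 := fun x hx ↦ by
      have : x ∈ LinearMap.ker (Matrix.toLin' (u - 1)) := hx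
      rwa [hbot, Submodule.mem_bot] at this
    have hprod : (u - 1) * (u + 1) = 0 := by
      have e : (u - 1) * (u + 1) = u * u - 1 := by noncomm_ring
      rw [e, h, sub_self]
    have hzero : Matrix.toLin' (u + 1) = 0 := by
      refine LinearMap.ext fun x ↦ hinj _ ?_
      rw [← LinearMap.comp_apply, ← Matrix.toLin'_mul, hprod, map_zero, LinearMap.zero_apply]
    rw [LinearEquiv.map_eq_zero_iff] at hzero
    have hu : u = -1 := eq_neg_of_add_eq_zero_left hzero
    rw [hu, Matrix.det_neg, Matrix.det_one, Fintype.card_fin] at hdet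
    revert hdet
    decide
  · intro htop
    have h0 : Matrix.toLin' (u - 1) = 0 := LinearMap.ker_eq_top.mp htop
    rw [LinearEquiv.map_eq_zero_iff, sub_eq_zero] at h0
    rw [h0, Matrix.det_one] at hdet
    revert hdet
    decide

end Matrices

end Summit.BirchSwinnertonDyer.BirchSwinnertonDyer.Theorems.TameQuarticManinParity

end
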